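import Literature.Analysis.FluidPDE.BoltzmannEquation
import Literature.Analysis.FluidPDE.WeakSolution
import Literature.Analysis.FluidPDE.LerayHopf
import Literature.Analysis.FluidPDE.PassiveScalar
import Literature.Analysis.UnboundedOperators.LinearizedBoltzmann
import HarnessLib

-- provenance: harness21/H21/H21/Prelude/FluidKinetic/HydrodynamicLimit.lean @ 5e1bfb2 (interim HEAD d8f2665); M5 mechanical rewrite
/-!
# Hydrodynamic scalings of the Boltzmann equation and the incompressible limit
(trunk: FluidKinetic / T-KINETIC, item K6; notion `hydrodynamic_scalings`)

This prelude file provides the vocabulary of the (incompressible) hydrodynamic limits of the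
Boltzmann equation, in the conventions of the accepted files
`Literature.Prelude.FluidKinetic.BoltzmannEquation` (K4: `Kinetic.collisionOpWith`,
`Kinetic.IsMildBoltzmannSolutionOn`, `Kinetic.IsRenormalisedSolution`, `Kinetic.globalMaxwellian`)
and `Literature.Prelude.UnbddOp.LinearizedBoltzmann` (G07: `Literature.Analysis.UnboundedOperators.maxwellianInner`,
`Literature.Analysis.UnboundedOperators.collisionInvariants`, `Literature.Analysis.UnboundedOperators.linearizedCollisionOp`, `Literature.Analysis.UnboundedOperators.burnettA`, `Literature.Analysis.UnboundedOperators.burnettB`), namely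

* the *scaled* Boltzmann equation `St ∂ₜf + v·∇ₓf = Kn⁻¹ Q_B(f, f)` (Strouhal number `St`,
  Knudsen number `Kn`; Saint-Raymond LNM 1971 §2.2, (2.13); Bardos–Golse–Levermore 1991 (2.1);
  Golse–Saint-Raymond 2004 (1.4) with `St = Kn = ε`) in mild, renormalised and classical form,
  obtained from the K4 notions by *un-scaling* time and rescaling the kernel
  (`Kinetic.IsMildScaledBoltzmannSolutionOn`, `Kinetic.IsRenormalisedScaledSolution`,
  `Kinetic.IsClassicalScaledBoltzmannSolutionOn`);
* fluctuations `g` around the global Maxwellian, `f = M (1 + δ g)` (`Kinetic.fluctuation`), their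
  Maxwellian moments `⟨ψ g⟩ = ∫ ψ g dM` **against `stdGaussian E`** (`Kinetic.maxwellMoment`,
  `= Literature.maxwellianInner`), the hydrodynamic fields `ρ = ⟨g⟩`, `u = ⟨v g⟩`,
  `θ = ⟨(|v|²/d - 1) g⟩` (`densityFluct`, `bulkVelocity`, `temperatureFluct`), infinitesimal
  Maxwellians `ρ + u·v + θ (|v|² - d)/2` (`IsInfinitesimalMaxwellian`), the Boussinesq relation
  `ρ + θ = 0` (`IsBoussinesq`), the collision operator in fluctuation variables
  `M⁻¹ Q(M g, M h)` (`fluctCollisionOp`) and the coordinate-free Burnett tensors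
  `A(v) = v ⊗ v - |v|²/d Id`, `B(v) = ½ (|v|² - (d+2)) v` (`kineticStressA`, `heatFluxB`);
* weak space–time convergence against a class of test functions (`TendstoWeaklySpaceTime`), the
  whole-space weak advection–diffusion (Fourier) equation `∂ₜθ + u·∇θ = κ Δθ`
  (`Fluid.IsWeakAdvectionDiffusionOn`, twin of the accepted `Torus.IsWeakScalarTransportOn`), and
  the target of the incompressible Navier–Stokes–Fourier limit on `T^d` and on `ℝ^d`
  (`IsIncompressibleNSFLimitTorus`, `IsIncompressibleNSFLimit`);
* the API theorems: `St = Kn = 1` is the unscaled equation (real proof), classical scaled ⇒ mild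
  scaled, the local conservation laws `⟨ψ M⁻¹Q(F,F)⟩ = 0` for collision invariants `ψ`
  (`maxwellianInner_collisionInvariant_collisionOpWith_eq_zero`, one profile `F : E → ℝ`, with
  the `collisionTerm` corollary), and the
  Bardos–Golse–Levermore *formal* incompressible limit (BGL 1991 §3, (3.9)–(3.14)): the limiting
  fluctuation is an infinitesimal Maxwellian with divergence-free bulk velocity satisfying the
  Boussinesq relation (`isInfinitesimalMaxwellian_of_tendsto`, hypotheses bundled in the
  hypothesis structure `BGLMomentHypotheses`).

## Mathlib / H21 reuse

Mathlib has no kinetic theory (grep `Boltzmann|Knudsen|hydrodynamic|Maxwellian`: nothing relevant).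
Reused: `ProbabilityTheory.stdGaussian` (the Maxwellian measure `M dv`, convention shared with
G07, review finding 8), `Module.finrank`, `innerSL`, `ContinuousLinearMap.smulRight`,
`OrthonormalBasis.repr`, `Laplacian.laplacian` (`Δ`), `gradient`, `deriv`/`derivWithin`/`fderiv`,
`Filter.Tendsto`, Bochner integrals. From H21: everything listed above plus `Fluid.slab`,
`Fluid.IsSpaceTimeTestOn`, `Fluid.timeDeriv`, `Fluid.IsWeaklyDivFree`, `Fluid.IsGlobalLerayHopf`,
`Torus.IsGlobalLerayHopf`, `Torus.IsWeakScalarTransportOn`, `Euclidean.geometry`.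

## Design choices

* **Scaling by un-scaling** (review finding 2). If `f` solves `St ∂ₜf + v·∇ₓf = Kn⁻¹ Q_B(f,f)` on
  `[0, T]`, then `g τ := f (St τ)` satisfies
  `∂_τ g + v·∇ₓ g = (St ∂ₜf + v·∇ₓf)(St τ) = Kn⁻¹ Q_B(g, g)(τ) = Q_{Kn⁻¹ B}(g, g)(τ)` for
  `τ ∈ [0, T / St]` (`collisionOpWith_smul`). Hence the scaled mild / renormalised notions are the
  K4 notions for the kernel `Kn⁻¹ • B`, the horizon `T / St` and the time-dilated density
  `fun τ ↦ f (St * τ)`; `St, Kn > 0` intended (for `St = 0` or `Kn = 0` the definitions are junk: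
  `x / 0 = 0`, `0⁻¹ = 0`). The pointwise PDE is kept as the faithfulness anchor
  `IsClassicalScaledBoltzmannSolutionOn`.
* Velocity space is an abstract finite-dimensional inner product space `E` (as in Wave0 / G07);
  all Maxwellian moments are integrals against `stdGaussian E`; the explicit density
  `globalMaxwellian` enters only in `fluctuation` and `fluctCollisionOp`.
* `IsInfinitesimalMaxwellian` is the explicit `(ρ, u, θ)` parametrisation of BGL (3.14); the link
  to G07's `collisionInvariants` is the real lemma
  `isInfinitesimalMaxwellian_iff_mem_collisionInvariants`.
* The BGL formal theorem is a *conditional* theorem: its convergence, remainder and regularity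
  hypotheses (BGL 1991 §3, standing assumptions of the formal theorem, in moment form) are bundled in the
  `Prop`-valued hypothesis structure `BGLMomentHypotheses` (positions in the vector space `E`,
  classical scaled solutions with `St = Kn = δ = εₖ → 0`). Following BGL 1991 §3, the local moment
  equations (3.9) of the fluctuations are *assumed* in weak form (field `moment_eq`): deriving them
  from the pointwise equation needs integrability of the gain/loss integrands and differentiation
  under the Gaussian integral, which `C¹` regularity alone does not give. The kernel hypothesis of
  the theorem is the `M`-a.e. form `L_B φ = 0 a.e. ⇒ φ` collision invariant, which is what weak
  limits deliver.
* Deviation from the outline (recorded for H6Hydro): instead of one abstract hypothesis structure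
  `IsIncompressibleNSFLimit (ν κ) u θ` there are two concrete ones, `IsIncompressibleNSFLimitTorus`
  (positions in `UnitAddTorus d`, built on `Torus.IsGlobalLerayHopf` + `Torus.IsWeakScalarTransportOn`)
  and `IsIncompressibleNSFLimit` (positions in `E`, built on `Fluid.IsGlobalLerayHopf` +
  `Fluid.IsWeakAdvectionDiffusionOn`). Intended use downstream: H6Hydro S16/S17 (whole space,
  Golse–Saint-Raymond) use `IsIncompressibleNSFLimit` (and `Fluid.IsLerayHopfOn` via
  `Fluid.IsGlobalLerayHopf.isLerayHopfOn`), S18 (torus) uses `IsIncompressibleNSFLimitTorus`; the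
  name keeps the outline's `Kinetic.` prefix rather than `Torus.` because both are targets of a
  *kinetic* limit. The Boussinesq relation is deliberately *not* a field: it is a property of the
  kinetic fluctuation `g`, stated via `IsBoussinesq`.
* In `BGLMomentHypotheses` every weak identity / convergence is a statement about *separate*
  iterated integrals `∫ t, ∫ x, ψ · (moment)`, and the flux enters only through
  `∫∫ ⟨v φ g⟩·∇ₓψ`; this way passing to the limit needs no linearity or Fubini for
  possibly-junk Bochner integrals, and the local conservation laws (BGL (3.9)) are assumed at
  each `εₖ` exactly as BGL do.
* The Mathlib imports of the outline (`Bochner.Basic`, `Gaussian.Multivariate`) are provided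
  transitively by the H21 imports.
* `finrank ℝ E = d ≥ 1` is intended throughout (`|v|²/d`, `|v|² - d`); for the trivial space the
  casts/divisions are junk.

## References

* C. Bardos, F. Golse, D. Levermore, *Fluid dynamic limits of kinetic equations I. Formal
  derivations*, J. Stat. Phys. 63 (1991) 323–344, §2–3, (3.9)–(3.14).
* L. Saint-Raymond, *Hydrodynamic Limits of the Boltzmann Equation*, LNM 1971 (2009), §2.2–2.3.
* F. Golse, L. Saint-Raymond, *The Navier–Stokes limit of the Boltzmann equation for bounded
  collision kernels*, Invent. Math. 155 (2004) 81–161, §1.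
* C. Bardos, F. Golse, C. D. Levermore, CPAM 46 (1993) §2 (Burnett functions).
-/

open MeasureTheory Metric Real Set Filter Topology ProbabilityTheory Module Function
  TopologicalSpace
open scoped InnerProductSpace RealInnerProductSpace ENNReal NNReal Laplacian

noncomputable section

namespace Literature.Analysis.FluidPDE

/-! ## The scaled Boltzmann equation -/

section Scaled

variable {d : Type*} [Fintype d] {X : Type*}

/-- *Mild solution of the scaled Boltzmann equation* `St ∂ₜf + v·∇ₓf = Kn⁻¹ Q_B(f, f)` on
`[0, T]` for the geometry `G` (Saint-Raymond LNM 1971 §2.2 (2.13); Bardos–Golse–Levermore 1991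
(2.1); Golse–Saint-Raymond 2004 (1.4)), defined by un-scaling: with `g τ := f (St τ)` one has
`∂_τ g + v·∇ₓ g = (St ∂ₜf + v·∇ₓf)(St τ) = Kn⁻¹ Q_B(g, g)(τ)` and `τ ∈ [0, T/St]`, so `f` is a
scaled mild solution iff `g` is a mild solution (`IsMildBoltzmannSolutionOn`) on `[0, T / St]` for
the kernel `Kn⁻¹ • B`. Intended for `St, Kn > 0`. Golse–Saint-Raymond's regime `St = Kn = ε` is
`IsMildScaledBoltzmannSolutionOn T G B ε ε f`. [cite: LNM1971, §2.2 (2.13] -/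
def IsMildScaledBoltzmannSolutionOn (T : ℝ) (G : Geometry d X)
    (B : EuclideanSpace ℝ d × EuclideanSpace ℝ d → sphere (0 : EuclideanSpace ℝ d) 1 → ℝ)
    (St Kn : ℝ) (f : ℝ → X → EuclideanSpace ℝ d → ℝ) : Prop :=
  IsMildBoltzmannSolutionOn (T / St) G (Kn⁻¹ • B) (fun τ => f (St * τ))

/-- With `St = Kn = 1` the scaled mild notion is the unscaled one of K4. [folklore] -/
theorem isMildScaledBoltzmannSolutionOn_one_one {T : ℝ} {G : Geometry d X}
    {B : EuclideanSpace ℝ d × EuclideanSpace ℝ d → sphere (0 : EuclideanSpace ℝ d) 1 → ℝ}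
    {f : ℝ → X → EuclideanSpace ℝ d → ℝ} :
    IsMildScaledBoltzmannSolutionOn T G B 1 1 f ↔ IsMildBoltzmannSolutionOn T G B f := by
  simp only [IsMildScaledBoltzmannSolutionOn, inv_one, one_smul, one_mul, div_one]

variable {E : Type*} [NormedAddCommGroup E] [InnerProductSpace ℝ E] [FiniteDimensional ℝ E]
  [MeasurableSpace E] [BorelSpace E]

/-- *Renormalised solution of the scaled Boltzmann equation* `St ∂ₜf + v·∇ₓf = Kn⁻¹ Q_B(f, f)`
on `[0, ∞) × E × E` (Golse–Saint-Raymond 2004 §1, (1.4) with `St = Kn = ε`; Saint-Raymond LNM 1971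
§2.3): the DiPerna–Lions notion `IsRenormalisedSolution` for the kernel `Kn⁻¹ • B` and the
time-dilated density `τ ↦ f (St τ)` (same change of variables as
`IsMildScaledBoltzmannSolutionOn`). Intended for `St, Kn > 0`. [cite: GolseSaintRaymond2004, §1  (1.4] -/
def IsRenormalisedScaledSolution (St Kn : ℝ) (B : E × E → sphere (0 : E) 1 → ℝ)
    (f : ℝ → E → E → ℝ) : Prop :=
  IsRenormalisedSolution (Kn⁻¹ • B) (fun τ => f (St * τ))

/-- With `St = Kn = 1` the scaled renormalised notion is the unscaled one of K4. [folklore] -/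
theorem isRenormalisedScaledSolution_one_one {B : E × E → sphere (0 : E) 1 → ℝ}
    {f : ℝ → E → E → ℝ} :
    IsRenormalisedScaledSolution 1 1 B f ↔ IsRenormalisedSolution B f := by
  simp only [IsRenormalisedScaledSolution, inv_one, one_smul, one_mul]

/-- **Faithfulness anchor.** *Classical solution of the scaled Boltzmann equation* on the time
set `S` with positions in the vector space `E`: `f` is `C¹` on `S × E × E`, nonnegative, and
`St ∂ₜf + v·∇ₓf = Kn⁻¹ Q_B(f, f)` holds pointwise, the time derivative being taken within `S`
(Saint-Raymond LNM 1971 §2.2 (2.13); Bardos–Golse–Levermore 1991 (2.1)). Intended for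
`St, Kn > 0`: `Kn = 0` gives free transport (`0⁻¹ = 0`), `St = 0` a stationary constraint. [cite: LNM1971, §2.2 (2.13] -/
structure IsClassicalScaledBoltzmannSolutionOn (S : Set ℝ) (St Kn : ℝ)
    (B : E × E → sphere (0 : E) 1 → ℝ) (f : ℝ → E → E → ℝ) : Prop where
  /-- `f ∈ C¹(S × E × E)`. -/
  contDiffOn : ContDiffOn ℝ 1 (fun z : ℝ × E × E => f z.1 z.2.1 z.2.2) (S ×ˢ univ)
  /-- `f ≥ 0`. -/
  nonneg : ∀ t ∈ S, ∀ x v, 0 ≤ f t x v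
  /-- The scaled equation `St ∂ₜf + v·∇ₓf = Kn⁻¹ Q_B(f, f)` pointwise on `S × E × E`. -/
  boltzmann : ∀ t ∈ S, ∀ x v,
    St * derivWithin (fun s => f s x v) S t + fderiv ℝ (fun y => f t y v) x v =
      Kn⁻¹ * collisionOpWith B (f t x) (f t x) v

/-- With `St = Kn = 1` a classical scaled solution is a classical solution in the sense of K4. [folklore] -/
theorem IsClassicalScaledBoltzmannSolutionOn.isClassicalBoltzmannSolutionOn {S : Set ℝ}
    {B : E × E → sphere (0 : E) 1 → ℝ} {f : ℝ → E → E → ℝ}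
    (hf : IsClassicalScaledBoltzmannSolutionOn S 1 1 B f) : IsClassicalBoltzmannSolutionOn S B f where
  contDiffOn := hf.contDiffOn
  nonneg := hf.nonneg
  boltzmann t ht x v := by simpa using hf.boltzmann t ht x v

/-- A classical scaled solution on `[0, T]` in `ℝ^d` (`St, Kn > 0`) is a mild scaled solution
for the whole-space geometry: the chain rule gives `∂_τ (f (St τ)) = St (∂ₜ f)(St τ)`, and one
integrates `d/dτ g♯ = Kn⁻¹ Q_B(g, g)♯` along characteristics (GST 2013 §2.1; Saint-Raymond LNM
1971 §2.2). This mirrors the accepted K4 theorem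
`IsClassicalBoltzmannSolutionOn.isMildBoltzmannSolutionOn` and inherits its weakness: interval
integrability of the collision term along characteristics (a Bochner integral) is not implied by
`C¹` regularity of `f` alone; the same integrability hypothesis should be added here when K4 is
revised. [cite: GST2013, §2.1] -/
def IsClassicalScaledBoltzmannSolutionOn.isMildScaledBoltzmannSolutionOn : Prop :=
  ∀ {T St Kn : ℝ} {B : EuclideanSpace ℝ d × EuclideanSpace ℝ d → sphere (0 : EuclideanSpace ℝ d) 1 → ℝ} {f : ℝ → EuclideanSpace ℝ d → EuclideanSpace ℝ d → ℝ} (hf : IsClassicalScaledBoltzmannSolutionOn (Icc 0 T) St Kn B f) (hSt : 0 < St) (hKn : 0 < Kn),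
    IsMildScaledBoltzmannSolutionOn T (Euclidean.geometry d) B St Kn f

end Scaled

/-! ## Fluctuations around the global Maxwellian and their moments -/

section Fluctuation

variable {E : Type*} [NormedAddCommGroup E] [InnerProductSpace ℝ E] {X : Type*}

/-- The *fluctuation* of size `δ` of a density `f` around the global Maxwellian `M`:
`g(x, v) = (f(x, v) / M(v) - 1) / δ`, i.e. `f = M (1 + δ g)` (Bardos–Golse–Levermore 1991 (3.1);
Saint-Raymond LNM 1971 §2.2; Golse–Saint-Raymond 2004 (1.5) with `δ = ε`). Needs the explicit
density `globalMaxwellian > 0`; junk value for `δ = 0`. [cite: BardosGolseLevermore1991, (3.1] -/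
def fluctuation (δ : ℝ) (f : X → E → ℝ) (x : X) (v : E) : ℝ :=
  (f x v / globalMaxwellian v - 1) / δ

/-- `f = M (1 + δ g)` for the fluctuation `g` of `f`, when `δ ≠ 0` (BGL 1991 (3.1)). [cite: BGL1991, (3.1] -/
theorem globalMaxwellian_mul_fluctuation {δ : ℝ} (hδ : δ ≠ 0) (f : X → E → ℝ) (x : X) (v : E) :
    globalMaxwellian v * (1 + δ * fluctuation δ f x v) = f x v := by
  have hM := (globalMaxwellian_pos v).ne'
  unfold fluctuation
  field_simp
  ring

/-- The fluctuation of `M (1 + δ g)` is `g` (`δ ≠ 0`). [folklore] -/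
theorem fluctuation_globalMaxwellian_mul {δ : ℝ} (hδ : δ ≠ 0) (g : X → E → ℝ) (x : X) (v : E) :
    fluctuation δ (fun x v => globalMaxwellian v * (1 + δ * g x v)) x v = g x v := by
  have hM := (globalMaxwellian_pos v).ne'
  unfold fluctuation
  field_simp
  ring

/-- *Infinitesimal Maxwellians*: `g(x, v) = ρ(x) + u(x)·v + θ(x) (|v|² - d)/2` for some fields
`(ρ, u, θ)`, the linearisation at `M` of the local Maxwellians `M_{1+δρ, δu, 1+δθ}`
(Bardos–Golse–Levermore 1991 (3.14); Saint-Raymond LNM 1971 §2.3). Equivalently `g(x, ·)` is a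
collision invariant for every `x` (`isInfinitesimalMaxwellian_iff_mem_collisionInvariants`). [cite: BardosGolseLevermore1991, (3.14] -/
def IsInfinitesimalMaxwellian (g : X → E → ℝ) : Prop :=
  ∃ (ρ : X → ℝ) (u : X → E) (θ : X → ℝ), ∀ x v,
    g x v = ρ x + ⟪u x, v⟫ + θ x * (‖v‖ ^ 2 - finrank ℝ E) / 2

/-- A velocity profile is an infinitesimal Maxwellian iff each `g(x, ·)` lies in G07's space of
collision invariants `span {1, vᵢ, |v|²}` (BGL 1991 (3.13)–(3.14); CIP 1994 §3.1). [cite: BGL1991, (3.13] -/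
theorem isInfinitesimalMaxwellian_iff_mem_collisionInvariants {g : X → E → ℝ} :
    IsInfinitesimalMaxwellian g ↔ ∀ x, g x ∈ UnboundedOperators.collisionInvariants E := by
  simp only [UnboundedOperators.mem_collisionInvariants_iff]
  constructor
  · rintro ⟨ρ, u, θ, h⟩ x
    refine ⟨ρ x - θ x * finrank ℝ E / 2, θ x / 2, u x, funext fun v => ?_⟩
    rw [h x v]
    ring
  · intro h
    choose a c b hg using h
    refine ⟨fun x => a x + c x * finrank ℝ E, b, fun x => 2 * c x, fun x v => ?_⟩
    simp only [hg x]
    ring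

variable [FiniteDimensional ℝ E] [MeasurableSpace E]

/-- The Maxwellian moment `⟨ψ g⟩(x) = ∫ ψ(v) g(x, v) M(v) dv` of a velocity profile, an integral
against `stdGaussian E = M dv` (BGL 1991 §2, notation `⟨·⟩`; Saint-Raymond LNM 1971 §2.2). It is
G07's pairing: `maxwellMoment ψ g x = maxwellianInner ψ (g x)`. Junk value `0` if not
integrable. [cite: BGL1991, §2  notation  ⟨·⟩] -/
def maxwellMoment (ψ : E → ℝ) (g : X → E → ℝ) (x : X) : ℝ :=
  ∫ v, ψ v * g x v ∂stdGaussian E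

/-- `maxwellMoment` is G07's `maxwellianInner`, frozen in `x` (`simp` normal form, so that the
G07 API applies without unfolding). [folklore] -/
@[simp]
theorem maxwellMoment_eq_maxwellianInner (ψ : E → ℝ) (g : X → E → ℝ) (x : X) :
    maxwellMoment ψ g x = UnboundedOperators.maxwellianInner ψ (g x) :=
  rfl

/-- The density fluctuation `ρ(x) = ⟨g⟩(x) = ∫ g(x, v) M dv` (BGL 1991 (3.10)). [cite: BGL1991, (3.10] -/
def densityFluct (g : X → E → ℝ) : X → ℝ :=
  maxwellMoment 1 g

/-- The bulk velocity (momentum fluctuation) `u(x) = ⟨v g⟩(x) = ∫ g(x, v) v M dv ∈ E`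
(BGL 1991 (3.10)). [cite: BGL1991, (3.10] -/
def bulkVelocity (g : X → E → ℝ) (x : X) : E :=
  ∫ v, g x v • v ∂stdGaussian E

/-- The temperature fluctuation `θ(x) = ⟨(|v|²/d - 1) g⟩(x)` (BGL 1991 (3.10): for an
infinitesimal Maxwellian `ρ + u·v + θ (|v|² - d)/2` this recovers `θ`). `d = finrank ℝ E ≥ 1`
intended (the cast division is junk for the trivial space). [cite: BGL1991, (3.10] -/
def temperatureFluct (g : X → E → ℝ) (x : X) : ℝ :=
  ∫ v, (‖v‖ ^ 2 / finrank ℝ E - 1) * g x v ∂stdGaussian E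

/-- Unfolding `densityFluct` as a Gaussian integral. [folklore] -/
theorem densityFluct_apply (g : X → E → ℝ) (x : X) :
    densityFluct g x = ∫ v, g x v ∂stdGaussian E := by
  simp [densityFluct, UnboundedOperators.maxwellianInner]

/-- `temperatureFluct` is the Maxwellian moment against `|v|²/d - 1`. [folklore] -/
theorem temperatureFluct_eq_maxwellMoment (g : X → E → ℝ) :
    temperatureFluct g = maxwellMoment (fun v => ‖v‖ ^ 2 / finrank ℝ E - 1) g :=
  rfl

/-- The components of the bulk velocity are the moments against `v ↦ ⟪v, e⟫`:
`⟪u(x), e⟫ = ⟨⟪v, e⟫ g⟩(x)`, provided `v ↦ g(x, v) v` is `M`-integrable. [folklore] -/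
theorem inner_bulkVelocity (g : X → E → ℝ) (x : X) (e : E)
    (hg : Integrable (fun v => g x v • v) (stdGaussian E)) :
    ⟪bulkVelocity g x, e⟫ = maxwellMoment (fun v => ⟪v, e⟫) g x := by
  unfold bulkVelocity maxwellMoment
  rw [real_inner_comm, ← integral_inner hg e]
  congr 1 with v
  rw [real_inner_smul_right, real_inner_comm, mul_comm]

/-- The Maxwellian *flux moment* `⟨v ψ g⟩(x) = ∫ ψ(v) g(x, v) v M dv ∈ E` (BGL 1991 (3.9): the
flux in the local conservation law `St ∂ₜ⟨ψ g⟩ + divₓ ⟨v ψ g⟩ = …`). For `ψ = 1` this is the bulk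
velocity (`maxwellMomentFlux_one`). Junk value `0` if not integrable. [cite: BGL1991, (3.9] -/
def maxwellMomentFlux (ψ : E → ℝ) (g : X → E → ℝ) (x : X) : E :=
  ∫ v, (ψ v * g x v) • v ∂stdGaussian E

/-- `⟨v · 1 · g⟩ = ⟨v g⟩ = u`. [folklore] -/
@[simp]
theorem maxwellMomentFlux_one (g : X → E → ℝ) : maxwellMomentFlux 1 g = bulkVelocity g := by
  funext x
  simp [maxwellMomentFlux, bulkVelocity]

/-- The *Boussinesq relation* `ρ + θ = 0` between density and temperature fluctuations, the
trace of the incompressible limit on the infinitesimal Maxwellian (BGL 1991 (3.12) and the remark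
after (3.14): `∇ₓ(ρ + θ) = 0`, hence `ρ + θ = 0` for fluctuations vanishing at infinity;
Golse–Saint-Raymond 2004 §1, main theorem). [cite: BGL1991, (3.12] -/
def IsBoussinesq (g : X → E → ℝ) : Prop :=
  ∀ x, densityFluct g x + temperatureFluct g x = 0

variable [BorelSpace E]

/-- The collision operator in fluctuation variables, `𝒬_B(g, h) = M⁻¹ Q_B(M g, M h)`
(BGL 1991 (3.3); Saint-Raymond LNM 1971 §2.2): the scaled equation for `f = M(1 + δ g)` reads
`St ∂ₜg + v·∇ₓg = Kn⁻¹ (L_B g + δ 𝒬_B(g, g))` with `L_B = Literature.linearizedCollisionOp B`. [cite: BGL1991, (3.3] -/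
def fluctCollisionOp (B : E × E → sphere (0 : E) 1 → ℝ) (g h : E → ℝ) (v : E) : ℝ :=
  (globalMaxwellian v)⁻¹ *
    collisionOpWith B (fun w => globalMaxwellian w * g w) (fun w => globalMaxwellian w * h w) v

/-- **Local conservation laws.** For a collision invariant `ψ ∈ span {1, vᵢ, |v|²}` and a Grad
cut-off (micro-reversible) kernel, the Maxwellian moment of `M⁻¹ Q_B(f, f)(t, x, ·)` vanishes:
`⟨ψ M⁻¹ Q_B(f,f)⟩ = ∫ ψ Q_B(f, f) dv = 0` — conservation of mass, momentum and energy, whence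
`St ∂ₜ⟨ψ f/M⟩ + divₓ ⟨v ψ f/M⟩ = 0` (BGL 1991 (2.4)–(2.6), (3.9); CIP 1994 §3.1 Cor. after
(3.1.9)), stated for one velocity profile `F : E → ℝ`. Hypothesis `hint`: the weak-formulation
integrand `B (F'F'_* - F F_*) ψ(v)` is integrable on `E × E × S^{d-1}`; integrability of the
variants with `ψ(v')`, `ψ(v_*)`, `ψ(v'_*)` in place of `ψ(v)` (which the proof uses) follows from
`hint` by `hB.collide_neg` / `hB.swap_neg` and measure preservation of the collision map. [cite: BGL1991, (2.4] -/
def maxwellianInner_collisionInvariant_collisionOpWith_eq_zero : Prop :=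
  ∀ {B : E × E → sphere (0 : E) 1 → ℝ} (hB : IsGradCutoffKernel B) {ψ : E → ℝ} (hψ : ψ ∈ UnboundedOperators.collisionInvariants E) (F : E → ℝ) (hint : Integrable (fun q : (E × E) × sphere (0 : E) 1 => B q.1 q.2 * (F (Literature.MathematicalPhysics.KineticTheory.collide q.2 q.1).1 * F (Literature.MathematicalPhysics.KineticTheory.collide q.2 q.1).2 - F q.1.1 * F q.1.2) * ψ q.1.1) ((volume.prod volume).prod Literature.MathematicalPhysics.KineticTheory.sphereMeasure)),
    UnboundedOperators.maxwellianInner ψ (fun v => (globalMaxwellian v)⁻¹ * collisionOpWith B F F v) = 0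

/-- Local conservation laws along a kinetic density `f(t, x, v)`: the Maxwellian moment of
`M⁻¹ Q_B(f, f)(t, x, ·)` against a collision invariant vanishes (one-line corollary of
`maxwellianInner_collisionInvariant_collisionOpWith_eq_zero` with `F := f t x`; BGL 1991
(2.4)–(2.6), (3.9)). [cite: BGL1991, (2.4] -/
def maxwellMoment_collisionInvariant_collisionTerm_eq_zero : Prop :=
  ∀ {B : E × E → sphere (0 : E) 1 → ℝ} (hB : IsGradCutoffKernel B) {ψ : E → ℝ} (hψ : ψ ∈ UnboundedOperators.collisionInvariants E) (f : ℝ → X → E → ℝ) (t : ℝ) (x : X) (hint : Integrable (fun q : (E × E) × sphere (0 : E) 1 => B q.1 q.2 * (f t x (Literature.MathematicalPhysics.KineticTheory.collide q.2 q.1).1 * f t x (Literature.MathematicalPhysics.KineticTheory.collide q.2 q.1).2 - f t x q.1.1 * f t x q.1.2) * ψ q.1.1) ((volume.prod volume).prod Literature.MathematicalPhysics.KineticTheory.sphereMeasure)),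
    maxwellMoment ψ (fun y v => (globalMaxwellian v)⁻¹ * collisionTerm B f t y v) x = 0

/- interim proof relied on results that are now named facts (D-0014); demoted to a fact by the M5 import, proof preserved:
:=
  maxwellianInner_collisionInvariant_collisionOpWith_eq_zero hB hψ (f t x) hint
-/

end Fluctuation

/-! ## Burnett tensors (coordinate-free) -/

section Burnett

variable {E : Type*} [NormedAddCommGroup E] [InnerProductSpace ℝ E]

/-- The kinetic stress (momentum-flux Burnett) tensor `A(v) = v ⊗ v - (|v|²/d) Id`, as the
endomorphism `w ↦ ⟪v, w⟫ v - (|v|²/d) w` of `E` (BGL 1991 (3.11); Bardos–Golse–Levermore 1993 §2;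
Golse–Saint-Raymond 2004 (1.13)). Its matrix entries in an orthonormal basis are G07's
`burnettA` (`inner_kineticStressA_apply`). [cite: BGL1991, (3.11] -/
def kineticStressA (v : E) : E →L[ℝ] E :=
  (innerSL ℝ v).smulRight v - (‖v‖ ^ 2 / finrank ℝ E) • ContinuousLinearMap.id ℝ E

/-- `A(v) w = ⟪v, w⟫ v - (|v|²/d) w`. [folklore] -/
@[simp]
theorem kineticStressA_apply (v w : E) :
    kineticStressA v w = ⟪v, w⟫ • v - (‖v‖ ^ 2 / finrank ℝ E) • w := by
  simp [kineticStressA]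

/-- The entries of `A(v)` in an orthonormal basis `b` are the Burnett functions of G07:
`⟪A(v) b_j, b_i⟫ = A_{ij}(v) = vᵢ vⱼ - δ_{ij} |v|²/d`. [folklore] -/
theorem inner_kineticStressA_apply {ι : Type*} [Fintype ι] [DecidableEq ι]
    (b : OrthonormalBasis ι ℝ E) (i j : ι) (v : E) :
    ⟪kineticStressA v (b j), b i⟫ = UnboundedOperators.burnettA b i j v := by
  rw [kineticStressA_apply, inner_sub_left, inner_smul_left, inner_smul_left, b.inner_eq_ite,
    UnboundedOperators.burnettA, b.repr_apply_apply, b.repr_apply_apply, real_inner_comm (b i),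
    real_inner_comm (b j) v]
  simp only [conj_trivial, eq_comm (a := j)]
  split_ifs <;> ring

/-- The heat-flux Burnett vector `B(v) = ½ (|v|² - (d + 2)) v ∈ E` (BGL 1991 (3.11);
Bardos–Golse–Levermore 1993 §2; Golse–Saint-Raymond 2004 (1.13)). Its coordinates in an
orthonormal basis are G07's `burnettB` (`repr_heatFluxB`). [cite: BGL1991, (3.11] -/
def heatFluxB (v : E) : E :=
  (2 : ℝ)⁻¹ • (‖v‖ ^ 2 - (finrank ℝ E + 2)) • v

/-- The coordinates of `B(v)` in an orthonormal basis `b` are the Burnett functions of G07: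
`(B(v))ᵢ = B_i(v) = ½ vᵢ (|v|² - (d+2))`. [folklore] -/
theorem repr_heatFluxB {ι : Type*} [Fintype ι] (b : OrthonormalBasis ι ℝ E) (i : ι) (v : E) :
    b.repr (heatFluxB v) i = UnboundedOperators.burnettB b i v := by
  simp only [heatFluxB, map_smul, UnboundedOperators.burnettB, PiLp.smul_apply, smul_eq_mul]
  ring

end Burnett

/-! ## Weak space–time convergence -/

section Tendsto

variable {X : Type*} [MeasureSpace X] {V : Type*} [NormedAddCommGroup V] [NormedSpace ℝ V]

/-- Weak (distributional) space–time convergence of a sequence of fields `Fₖ : ℝ → X → V`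
towards `F` against a class `𝒯` of real test functions:
`∫∫ ψ Fₖ dx dt → ∫∫ ψ F dx dt` for every `ψ ∈ 𝒯` (BGL 1991 §3, convergence "in the sense of
distributions"; Golse–Saint-Raymond 2004 §1 (main theorem), `w-L¹_loc(dt dx)`). The test class is a
parameter: statements use `{ψ | Torus.IsSpaceTimeTestIoo T ψ}` on the torus and
`{ψ | Fluid.IsSpaceTimeTestOn (Fluid.slab X (Ioo 0 T) isOpen_Ioo) ψ}` on a vector space.
Iterated Bochner integrals (junk value `0`). [cite: BGL1991, §3  convergence "in the sense of distrib] -/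
def TendstoWeaklySpaceTime (𝒯 : Set (ℝ → X → ℝ)) (Fk : ℕ → ℝ → X → V) (F : ℝ → X → V) :
    Prop :=
  ∀ ψ ∈ 𝒯, Tendsto (fun k => ∫ t, ∫ x, ψ t x • Fk k t x) atTop (𝓝 (∫ t, ∫ x, ψ t x • F t x))

/-- A constant sequence converges weakly to its value. [folklore] -/
theorem tendstoWeaklySpaceTime_const (𝒯 : Set (ℝ → X → ℝ)) (F : ℝ → X → V) :
    TendstoWeaklySpaceTime 𝒯 (fun _ => F) F :=
  fun _ _ => tendsto_const_nhds

/-- Weak space–time convergence is monotone (contravariant) in the test class. [folklore] -/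
theorem TendstoWeaklySpaceTime.mono {𝒯 𝒯' : Set (ℝ → X → ℝ)} {Fk : ℕ → ℝ → X → V}
    {F : ℝ → X → V} (h : TendstoWeaklySpaceTime 𝒯 Fk F) (h' : 𝒯' ⊆ 𝒯) :
    TendstoWeaklySpaceTime 𝒯' Fk F :=
  fun ψ hψ => h ψ (h' hψ)

end Tendsto

end Literature.Analysis.FluidPDE

/-! ## The whole-space weak advection–diffusion (Fourier) equation -/

namespace Literature.Analysis.FluidPDE

variable {E : Type*} [NormedAddCommGroup E] [InnerProductSpace ℝ E] [FiniteDimensional ℝ E]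
  [MeasurableSpace E] [BorelSpace E]

/-- Weak (distributional) solutions of the advection–diffusion equation `∂ₜθ + u·∇θ = κ Δθ` on
`E × [0, T)` with datum `θ₀` and given drift `u`; the whole-space twin of the accepted
`Literature.Analysis.FluidPDE.Torus.IsWeakScalarTransportOn` (same fields, same order), with space–time tests
`ψ ∈ C_c^∞((-∞, T) × E)` (`Fluid.IsSpaceTimeTestOn (slab E (Iio T) _)`, possibly nonzero at
`t = 0`): `θ`, `u` a.e. strongly measurable on `(0,T) × E`; `θ ∈ L^∞(0,T; L²)`;
`u ∈ L¹(0,T; L²)`; `u θ ∈ L¹((0,T) × E)`; `u(t)` weakly divergence free for a.e. `t`; and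
`∫₀ᵀ ∫ θ (∂ₜψ + u·∇ψ + κ Δψ) dx dt + ∫ θ₀ ψ(0) dx = 0` (DiPerna–Lions, Invent. Math. 98 (1989)
§II.1 (12)–(14); Evans, *PDE*, §7.1.2; this is the temperature (Fourier) equation of the
incompressible Navier–Stokes–Fourier limit, BGL 1991 §3 (3.12)–(3.14), Golse–Saint-Raymond 2004 (1.17)). [cite: BGL1991, §3 (3.12] -/
structure IsWeakAdvectionDiffusionOn (T κ : ℝ) (u : ℝ → E → E) (θ₀ : E → ℝ) (θ : ℝ → E → ℝ) :
    Prop where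
  /-- `θ` is a.e. strongly measurable on `(0,T) × E`. -/
  aestronglyMeasurable : AEStronglyMeasurable (uncurry θ) (volume.restrict (Ioo 0 T ×ˢ univ))
  /-- `u` is a.e. strongly measurable on `(0,T) × E`. -/
  aestronglyMeasurable_velocity :
    AEStronglyMeasurable (uncurry u) (volume.restrict (Ioo 0 T ×ˢ univ))
  /-- `θ ∈ L^∞(0,T; L²(E))`: `∫ |θ(t)|² ≤ C` for a.e. `t ∈ (0,T)`. -/
  ae_lintegral_sq_le : ∃ C : ℝ≥0, ∀ᵐ t ∂(volume.restrict (Ioo 0 T)), ∫⁻ x, ‖θ t x‖ₑ ^ 2 ≤ C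
  /-- `u ∈ L¹(0,T; L²(E))`. -/
  lintegral_velocity_lt_top : ∫⁻ t in Ioo 0 T, (∫⁻ x, ‖u t x‖ₑ ^ 2) ^ (1 / 2 : ℝ) < ∞
  /-- `u θ ∈ L¹((0,T) × E)`. -/
  lintegral_mul_lt_top : ∫⁻ t in Ioo 0 T, ∫⁻ x, ‖u t x‖ₑ * ‖θ t x‖ₑ < ∞
  /-- `div u(t) = 0` weakly, for a.e. `t ∈ (0,T)`. -/
  ae_isWeaklyDivFree : ∀ᵐ t ∂(volume.restrict (Ioo 0 T)), IsWeaklyDivFree (u t)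
  /-- The weak formulation with datum: `∫₀ᵀ ∫ θ (∂ₜψ + u·∇ψ + κΔψ) + ∫ θ₀ ψ(0) = 0`. -/
  weak_eq : ∀ ψ : ℝ → E → ℝ, IsSpaceTimeTestOn (slab E (Iio T) isOpen_Iio) ψ →
    (∫ t in Ioo 0 T, ∫ x, θ t x *
        (timeDeriv ψ t x + ⟪u t x, gradient (ψ t) x⟫ + κ * Δ (ψ t) x)) +
      ∫ x, θ₀ x * ψ 0 x = 0

/-- A weak solution on `[0, T)` is a weak solution on every shorter `[0, T')`, `T' ≤ T`
(tests on the smaller slab are tests on the larger one and the extra time integral vanishes; for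
`T' ≤ 0` the time integral is over `∅` and tests supported in `(-∞, T') × E` vanish at `t = 0`,
so no sign hypothesis on `T'` is needed). An elementary property of this file's own definition
`IsWeakAdvectionDiffusionOn` (no single source; not yet discharged in the tree). [folklore] -/
def IsWeakAdvectionDiffusionOn.mono : Prop :=
  ∀ {T T' κ : ℝ} {u : ℝ → E → E} {θ₀ : E → ℝ} {θ : ℝ → E → ℝ} (h : IsWeakAdvectionDiffusionOn T κ u θ₀ θ) (hT : T' ≤ T),
    IsWeakAdvectionDiffusionOn T' κ u θ₀ θ

end Literature.Analysis.FluidPDE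

/-! ## The incompressible Navier–Stokes–Fourier limit -/

namespace Literature.Analysis.FluidPDE

section NSF

/-- The target of the incompressible Navier–Stokes–Fourier limit on the flat torus `T^d`
(Bardos–Golse–Levermore 1991 (3.12)–(3.14) with §4; Golse–Saint-Raymond 2004 (1.17)–(1.18);
Saint-Raymond LNM 1971 §2.3): `u` is a global Leray–Hopf solution of the unforced
incompressible Navier–Stokes equations with viscosity `ν` and datum `u₀`
(`Torus.IsGlobalLerayHopf`), and `θ` is a weak solution of the Fourier equation
`∂ₜθ + u·∇θ = κ Δθ` with datum `θ₀` on every `[0, T)` (`Torus.IsWeakScalarTransportOn`). [cite: BardosGolseLevermore1991, (3.12] -/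
structure IsIncompressibleNSFLimitTorus {d : Type*} [Fintype d] [DecidableEq d] (ν κ : ℝ)
    (u₀ : UnitAddTorus d → EuclideanSpace ℝ d) (θ₀ : UnitAddTorus d → ℝ)
    (u : ℝ → UnitAddTorus d → EuclideanSpace ℝ d) (θ : ℝ → UnitAddTorus d → ℝ) : Prop where
  /-- `u` is a global Leray–Hopf solution with datum `u₀` (no force). -/
  isGlobalLerayHopf : Torus.IsGlobalLerayHopf ν 0 u₀ u
  /-- `θ` solves the Fourier equation with drift `u` weakly on every `[0, T)`. -/
  isWeakScalarTransportOn : ∀ T > 0, Torus.IsWeakScalarTransportOn T κ u θ₀ θ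

variable {E : Type*} [NormedAddCommGroup E] [InnerProductSpace ℝ E] [FiniteDimensional ℝ E]
  [MeasurableSpace E] [BorelSpace E]

/-- The target of the incompressible Navier–Stokes–Fourier limit on the whole space `E`
(Bardos–Golse–Levermore 1991 (3.12)–(3.14); Golse–Saint-Raymond 2004 §1 (main theorem), (1.17)–(1.18)):
`u` is a global Leray–Hopf solution (`Fluid.IsGlobalLerayHopf`, no force, datum `u₀`) and `θ` a
weak solution of `∂ₜθ + u·∇θ = κ Δθ` with datum `θ₀` on every `[0, T)`
(`Fluid.IsWeakAdvectionDiffusionOn`). [cite: BardosGolseLevermore1991, (3.12] -/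
structure IsIncompressibleNSFLimit (ν κ : ℝ) (u₀ : E → E) (θ₀ : E → ℝ) (u : ℝ → E → E)
    (θ : ℝ → E → ℝ) : Prop where
  /-- `u` is a global Leray–Hopf solution with datum `u₀` (no force). -/
  isGlobalLerayHopf : FluidPDE.IsGlobalLerayHopf ν 0 u₀ u
  /-- `θ` solves the Fourier equation with drift `u` weakly on every `[0, T)`. -/
  isWeakAdvectionDiffusionOn : ∀ T > 0, FluidPDE.IsWeakAdvectionDiffusionOn T κ u θ₀ θ

end NSF

/-! ## The Bardos–Golse–Levermore formal incompressible limit -/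

section BGL

variable {E : Type*} [NormedAddCommGroup E] [InnerProductSpace ℝ E] [FiniteDimensional ℝ E]
  [MeasurableSpace E] [BorelSpace E]

/-- **Hypothesis structure for the BGL formal limit** (Bardos–Golse–Levermore 1991 §3, the
standing assumptions of the formal Thm: (3.4)–(3.9)). Positions live in the vector space `E`
(free transport `x + t v`); `T > 0` intended (for `T ≤ 0` the test class on `(0, T) × E` is
trivial and `isInfinitesimalMaxwellian_of_tendsto` is vacuous). Data: a sequence `εₖ → 0⁺`,
classical solutions `fₖ` of the scaled Boltzmann equation `εₖ ∂ₜf + v·∇ₓf = εₖ⁻¹ Q_B(f, f)` on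
`[0, T]` (`St = Kn = εₖ`, the incompressible Navier–Stokes scaling), their fluctuations
`gₖ = (fₖ/M - 1)/εₖ = fluctuation εₖ (fₖ t)`, and a candidate limit `g`. Assumptions, all in
Maxwellian-moment form against smooth compactly supported space–time tests `ψ` on `(0, T) × E`
(so `∫ t, …` and `∫ t in Ioo 0 T, …` agree) and velocity weights `φ` of temperate growth:
(i) the moments `⟨φ gₖ⟩` converge weakly to `⟨φ g⟩`;
(i') the divergences of the flux moments converge in `𝒟'`:
`∫∫ ⟨v φ gₖ⟩·∇ₓψ → ∫∫ ⟨v φ g⟩·∇ₓψ` (stated in exactly the form in which the flux enters (v-a),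
(v-b), so that no linearity/Fubini manipulation of possibly-junk Bochner integrals is needed; it
follows from weak convergence of the flux moments whenever these are locally integrable);
(ii) the linearised collision moments `⟨φ L_B gₖ⟩` converge weakly to `⟨φ L_B g⟩`;
(iii) the nonlinear remainders `εₖ ⟨φ 𝒬_B(gₖ, gₖ)⟩` tend to `0` weakly;
(iv) the limit is regular enough for the formal argument to be pointwise: (a) `g` is continuous,
(b) `g(t, x, ·)` has temperate growth, (c) its moments, flux moments and linearised-collision
moments are continuous in `(t, x)`, and (d) `g(t) ∈ L²(dx M dv)` (this last condition does real
work: without it `fₖ = (1 + εₖ) M`, `g ≡ 1`, would violate the Boussinesq relation);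
(v) as in BGL 1991 §3, who *assume* the local conservation laws and moment equations at each
`ε`, the fluctuations satisfy weakly on `(0, T) × E`:
(v-a) the *local conservation laws* (BGL (2.4)–(2.6), (3.9)) `εₖ ∂ₜ⟨φ gₖ⟩ + divₓ⟨v φ gₖ⟩ = 0`
for every collision invariant `φ ∈ span{1, vᵢ, |v|²}` (`conservation_eq`), and
(v-b) the *moment equations* `εₖ² ∂ₜ⟨φ gₖ⟩ + εₖ divₓ⟨v φ gₖ⟩ = ⟨φ L_B gₖ⟩ + εₖ ⟨φ 𝒬_B(gₖ, gₖ)⟩`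
for every `φ` of temperate growth (`moment_eq`) — the moment form of
`εₖ ∂ₜfₖ + v·∇ₓfₖ = εₖ⁻¹ Q_B(fₖ, fₖ)` with `fₖ = M(1 + εₖ gₖ)`,
`M⁻¹ Q_B(fₖ, fₖ) = εₖ (L_B gₖ + εₖ 𝒬_B(gₖ, gₖ))`, (v-a) being (v-b) divided by `εₖ` combined with
`⟨φ L_B gₖ⟩ = ⟨φ 𝒬_B(gₖ, gₖ)⟩ = 0` (`maxwellMoment_collisionInvariant_collisionTerm_eq_zero`).
Deriving (v) from `isClassical` would need integrability of the gain/loss integrands and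
differentiation under `∫ … ∂stdGaussian`, which `C¹` regularity does not provide (`gₖ` is only
continuous, so the Bochner integrals in `linearizedCollisionOp` / `fluctCollisionOp` may be junk),
so both are recorded as hypotheses. All weak identities are written as sums of *separate*
iterated integrals `∫ t, ∫ x, ψ · (moment)`, matching `TendstoWeaklySpaceTime` literally
(`smul_eq_mul`). [cite: BardosGolseLevermore1991, §3  the standing assumptions of the form] -/
structure BGLMomentHypotheses (T : ℝ) (B : E × E → sphere (0 : E) 1 → ℝ) (ε : ℕ → ℝ)
    (f : ℕ → ℝ → E → E → ℝ) (g : ℝ → E → E → ℝ) : Prop where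
  /-- `εₖ > 0`. -/
  pos_eps : ∀ k, 0 < ε k
  /-- `εₖ → 0`. -/
  tendsto_eps_zero : Tendsto ε atTop (𝓝 0)
  /-- `fₖ` is a classical solution of `εₖ ∂ₜf + v·∇ₓf = εₖ⁻¹ Q_B(f,f)` on `[0, T]`. -/
  isClassical : ∀ k, IsClassicalScaledBoltzmannSolutionOn (Icc 0 T) (ε k) (ε k) B (f k)
  /-- (i) Weak convergence of the moments `⟨φ gₖ⟩ → ⟨φ g⟩` for `φ` of temperate growth. -/
  tendsto_moment : ∀ φ ∈ UnboundedOperators.temperateGrowth E,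
    TendstoWeaklySpaceTime {ψ | FluidPDE.IsSpaceTimeTestOn (FluidPDE.slab E (Ioo 0 T) isOpen_Ioo) ψ}
      (fun k t => maxwellMoment φ (fluctuation (ε k) (f k t)))
      (fun t => maxwellMoment φ (g t))
  /-- (i') Distributional convergence of the divergences of the flux moments,
  `∫∫ ⟨v φ gₖ⟩·∇ₓψ → ∫∫ ⟨v φ g⟩·∇ₓψ` for every test `ψ`. -/
  tendsto_div_flux : ∀ φ ∈ UnboundedOperators.temperateGrowth E, ∀ ψ : ℝ → E → ℝ,
    FluidPDE.IsSpaceTimeTestOn (FluidPDE.slab E (Ioo 0 T) isOpen_Ioo) ψ →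
    Tendsto (fun k => ∫ t, ∫ x,
        ⟪maxwellMomentFlux φ (fluctuation (ε k) (f k t)) x, gradient (ψ t) x⟫) atTop
      (𝓝 (∫ t, ∫ x, ⟪maxwellMomentFlux φ (g t) x, gradient (ψ t) x⟫))
  /-- (ii) Weak convergence of the linearised collision moments `⟨φ L_B gₖ⟩ → ⟨φ L_B g⟩`. -/
  tendsto_linearized : ∀ φ ∈ UnboundedOperators.temperateGrowth E,
    TendstoWeaklySpaceTime {ψ | FluidPDE.IsSpaceTimeTestOn (FluidPDE.slab E (Ioo 0 T) isOpen_Ioo) ψ}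
      (fun k t => maxwellMoment φ
        (fun x => UnboundedOperators.linearizedCollisionOp B (fluctuation (ε k) (f k t) x)))
      (fun t => maxwellMoment φ (fun x => UnboundedOperators.linearizedCollisionOp B (g t x)))
  /-- (iii) The nonlinear remainders vanish: `εₖ ⟨φ 𝒬_B(gₖ, gₖ)⟩ → 0` weakly. -/
  tendsto_remainder : ∀ φ ∈ UnboundedOperators.temperateGrowth E,
    TendstoWeaklySpaceTime {ψ | FluidPDE.IsSpaceTimeTestOn (FluidPDE.slab E (Ioo 0 T) isOpen_Ioo) ψ}
      (fun k t => maxwellMoment φ (fun x v => ε k *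
        fluctCollisionOp B (fluctuation (ε k) (f k t) x) (fluctuation (ε k) (f k t) x) v))
      (fun _ _ => (0 : ℝ))
  /-- (iv-a) The limit fluctuation is jointly continuous. -/
  continuous_limit : Continuous (fun z : ℝ × E × E => g z.1 z.2.1 z.2.2)
  /-- (iv-b) `g(t, x, ·)` has temperate growth. -/
  mem_temperateGrowth : ∀ t x, g t x ∈ UnboundedOperators.temperateGrowth E
  /-- (iv-c) The moments, flux moments and `L_B`-moments of the limit are continuous in
  `(t, x)`. -/
  continuous_moment : ∀ φ ∈ UnboundedOperators.temperateGrowth E,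
    Continuous (fun p : ℝ × E => maxwellMoment φ (g p.1) p.2) ∧
      Continuous (fun p : ℝ × E => maxwellMomentFlux φ (g p.1) p.2) ∧
      Continuous (fun p : ℝ × E => maxwellMoment φ (fun x => UnboundedOperators.linearizedCollisionOp B (g p.1 x)) p.2)
  /-- (iv-d) `g(t) ∈ L²(dx M dv)` for `t ∈ (0, T)` (fluctuations vanish at infinity). -/
  integrable_sq : ∀ t ∈ Ioo 0 T,
    Integrable (fun z : E × E => g t z.1 z.2 ^ 2) ((volume : Measure E).prod (stdGaussian E))
  /-- (v-a) The weak local conservation laws of the fluctuations `gₖ = fluctuation εₖ (fₖ t)`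
  (BGL 1991 (2.4)–(2.6), (3.9)): for every collision invariant `φ` and `ψ ∈ C_c^∞((0,T) × E)`,
  `εₖ ∫∫ ∂ₜψ ⟨φ gₖ⟩ + ∫∫ ⟨v φ gₖ⟩·∇ₓψ = 0`. -/
  conservation_eq : ∀ k, ∀ φ ∈ UnboundedOperators.collisionInvariants E, ∀ ψ : ℝ → E → ℝ,
    FluidPDE.IsSpaceTimeTestOn (FluidPDE.slab E (Ioo 0 T) isOpen_Ioo) ψ →
    ε k * (∫ t, ∫ x, FluidPDE.timeDeriv ψ t x * maxwellMoment φ (fluctuation (ε k) (f k t)) x) +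
      ∫ t, ∫ x, ⟪maxwellMomentFlux φ (fluctuation (ε k) (f k t)) x, gradient (ψ t) x⟫ = 0
  /-- (v-b) The weak local moment equations of the fluctuations (BGL 1991 §3): for `φ` of
  temperate growth and `ψ ∈ C_c^∞((0,T) × E)`,
  `εₖ² ∫∫ ∂ₜψ ⟨φ gₖ⟩ + εₖ ∫∫ ⟨v φ gₖ⟩·∇ₓψ + ∫∫ ψ ⟨φ L_B gₖ⟩ + ∫∫ ψ ⟨φ εₖ 𝒬_B(gₖ,gₖ)⟩ = 0`. -/
  moment_eq : ∀ k, ∀ φ ∈ UnboundedOperators.temperateGrowth E, ∀ ψ : ℝ → E → ℝ,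
    FluidPDE.IsSpaceTimeTestOn (FluidPDE.slab E (Ioo 0 T) isOpen_Ioo) ψ →
    ε k ^ 2 * (∫ t, ∫ x, FluidPDE.timeDeriv ψ t x * maxwellMoment φ (fluctuation (ε k) (f k t)) x) +
      ε k * (∫ t, ∫ x, ⟪maxwellMomentFlux φ (fluctuation (ε k) (f k t)) x, gradient (ψ t) x⟫) +
      (∫ t, ∫ x, ψ t x *
        maxwellMoment φ (fun y => UnboundedOperators.linearizedCollisionOp B (fluctuation (ε k) (f k t) y)) x) +
      (∫ t, ∫ x, ψ t x * maxwellMoment φ (fun y w => ε k *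
        fluctCollisionOp B (fluctuation (ε k) (f k t) y) (fluctuation (ε k) (f k t) y) w) x) = 0

/-- **The Bardos–Golse–Levermore formal incompressible limit** (BGL, J. Stat. Phys. 63 (1991)
§3, (3.9)–(3.14); Saint-Raymond LNM 1971 §2.3). Under `BGLMomentHypotheses`, in velocity
dimension `d ≥ 2` and for a Grad cut-off kernel `B` such that every temperate-growth `φ` with
`L_B φ = 0` `M`-almost everywhere is a collision invariant (the a.e. form is what the weak limit
of (ii) delivers; for hard spheres it follows from `hardSphereLinearizedOp_eq_zero_iff` together
with continuity of `L_hs φ` in `v`), the limiting fluctuation is, for every `t ∈ (0, T)`: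
(1) an infinitesimal Maxwellian `g = ρ + u·v + θ(|v|² - d)/2` — let `k → ∞` in (v-b): the
`εₖ²`, `εₖ` terms vanish by (i), (i'), (iii), so `∫∫ ψ ⟨φ L_B g⟩ = 0` by (ii), pointwise by
(iv-c), hence `L_B g(t,x) = 0` `M`-a.e. and `hker` with
`isInfinitesimalMaxwellian_iff_mem_collisionInvariants` conclude;
(2) its bulk velocity is weakly divergence free — let `k → ∞` in (v-a) with `φ = 1`: the `εₖ`
term vanishes by (i), so `∫∫ ⟨v g⟩·∇ₓψ = 0` by (i'), per `t` by (iv-c) and `ψ = η(t) χ(x)`, and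
`⟨v · 1 · g⟩ = bulkVelocity` (`maxwellMomentFlux_one`);
(3) it satisfies the Boussinesq relation `ρ + θ = 0` — (v-a) with `φ = ⟪·, e⟫` gives in the limit
`∫∫ ⟨v ⟪v,e⟫ g⟩·∇ₓψ = 0`; for the infinitesimal Maxwellian of (1) the Gaussian moments
`⟨vᵢ vⱼ⟩ = ⟨vᵢ vⱼ (|v|² - d)/2⟩ = δᵢⱼ`, `⟨vᵢ vⱼ v_l⟩ = 0` give `⟨v ⟪v,e⟫ g⟩ = (ρ + θ) e`, so
`∇ₓ(ρ + θ) = 0` weakly, `ρ + θ` is constant in `x` (continuous by (iv-c)), lies in `L²(E)` by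
(iv-d), and `E ≠ 0` (`hE`) forces `ρ + θ = 0`. [cite: LNM1971, §2.3] -/
def isInfinitesimalMaxwellian_of_tendsto : Prop :=
  ∀ {T : ℝ} {B : E × E → sphere (0 : E) 1 → ℝ} {ε : ℕ → ℝ} {f : ℕ → ℝ → E → E → ℝ} {g : ℝ → E → E → ℝ} (h : BGLMomentHypotheses T B ε f g) (hB : IsGradCutoffKernel B) (hE : 2 ≤ finrank ℝ E) (hker : ∀ φ ∈ UnboundedOperators.temperateGrowth E, UnboundedOperators.linearizedCollisionOp B φ =ᵐ[stdGaussian E] 0 → φ ∈ UnboundedOperators.collisionInvariants E) {t : ℝ} (ht : t ∈ Ioo 0 T),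
    IsInfinitesimalMaxwellian (g t) ∧ FluidPDE.IsWeaklyDivFree (bulkVelocity (g t)) ∧
      IsBoussinesq (g t)

end BGL

end Literature.Analysis.FluidPDE

end
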